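import Summits.CriticalPhenomena.PercolationContinuityZ3.Theses.PercNonProliferation
import Summits.CriticalPhenomena.PercolationContinuityZ3.Theorems.NonProliferation.Negative.AboveSix
import Summits.CriticalPhenomena.PercolationContinuityZ3.Theorems.PercNonProliferationNonProliferationRatioDichotomy
import Summits.CriticalPhenomena.PercolationContinuityZ3.Theorems.PercNonProliferationNonProliferationStubSubshellCrossers
import Summits.CriticalPhenomena.PercolationContinuityZ3.Theorems.PercNonProliferationNonProliferationStubDisjointShellsIndep
import Summits.CriticalPhenomena.PercolationContinuityZ3.Theorems.PercNonProliferationNonProliferationStubShellOfBoxCrossers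
import Literature.Probability.Percolation.RSW
import HarnessLib

/-!
# Line `avoidance-cost-covering` — checked skeleton for the crux `NonProliferation`
# (stmt-CriticalPhenomena-4444, route `PercNonProliferation`, rank 2) — crux-plan gen 1 (2026-08-16)

Crux (fixed, by name): `PercNonProliferation.NonProliferation` —
`∃ M c, 0 < c ∧ ∃ᶠ n, c ≤ P_{p_c(ℤ³)}(N_n ≤ M)`, `N_n` = number of clusters of the open graph INDUCED on
`B(2n)` meeting both `B(n)` and `∂ⁱⁿB(2n)` (`{N_n ≤ M} = (repEvent 3 M n)ᶜ`, `Negative.nonProliferation_iff`).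

THE LINE (idea card `Cruxes/NonProliferation/Ideas/avoidance-cost-covering.md`, ideator 4; triage
`TRIAGE-r2-1.md` / `TRIAGE-r2-2.md`: pass ×2 in the SHARPENED three-crosser form, "C⁺ := ThreeCrosserDecay,
equivalently — by shell submultiplicativity — the ONE-RATIO criterion"; merged by the leads into
`Lines/boundary_pinning.lean` as its BULK composition, whose covering half is LANDED:
`nonProliferation_of_threeCrosserDecay` p124279, `nonProliferation_of_frequently_multiCross` p124993).
This skeleton is the half of the card that was NOT built: the AVOIDANCE-COST bootstrap. Each further aspect-ratio
factor `(k₀+1)` costs an independent factor `q` — the shells `Sh((k₀+1)^i a, k₀(k₀+1)^i a)`, `i = 0 … j`, are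
pairwise vertex-disjoint, every three-crosser family of the big shell `Sh(a, k₀(k₀+1)^j a)` restricts to a
three-crosser family of EACH of them (`stub_subshellCrossers`, first/last-visit surgery on lattice paths), and
events of disjoint shells are independent under the product measure (`stub_disjointShellsIndep`) — so ONE
inequality at ONE ratio, uniformly in the scale,
  `(k₀+1)² · sup_{a ≥ a₀} P_{p_c}(three shell-distinct crossers of Sh(a, k₀ a)) < 1`   (`stub_oneRatioThreeCrossers`, OPEN)
self-generates the power law `P(three crossers of Sh(a, k a)) ≲ k^{-log(1/q)/log(k₀+1)}` with exponent `> 2 = d-1`,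
which beats the `726 k²` translates of the landed mid-sphere covering (`nonProliferation_of_frequently_multiCross`,
any ratio `k`, multiplicity `r = 2`, frequently in `m`) once box-crossers are read as shell-crossers
(`stub_shellOfBoxCrossers`, last-visit surgery). No exponent is conjectured anywhere: the rate is produced by the
bootstrap, and the `d = 3` input is a single finite-ratio inequality (numerically first met near `k₀ ≈ 25–50`:
`k² P₃ = 9.7, 7.3, 4.2` at `k = 6, 8, 12`, `ζ₃,eff = 3.0–3.4`, kit j018168–72 / j014707; pairs can never do it,
`ζ₂ = d - 1/ν ≈ 1.86 < 2`, and at `k₀ = 2` the criterion is void since `P(N_sh(a,2a) ≥ 3) = 1.000` — which is what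
keeps the stub an exponent inequality `ζ₃ > 2` and not the ratio-2 tightness costume flagged by triage (α)).

STATUS (lead a1, 2026-08-16 22:40Z): stubs 2–4 LANDED (p129292 `stub_subshellCrossers`, p129213
`stub_disjointShellsIndep`, p129273 `stub_shellOfBoxCrossers`, all in `Theorems.NonProliferation`); ONE sorry left =
`stub_oneRatioThreeCrossers` (open; kit MC j020551–3, j020662 queued for its numerical certificate/falsifier).
Also landed around the open stub: the SOCKET `nonProliferation_of_oneRatioThreeCrossers` (p129664, this file's
`NonProliferation_of` with stubs 2–4 inlined: `stub_oneRatioThreeCrossers`-signature → crux), the CALIBRATION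
`oneRatioThreeCrossers_iff_shellThreeCrosserDecay` (p130012: the open stub ⟺ `ShellThreeCrosserDecay` below, i.e.
uniform power decay with SOME exponent `2 + δ > 2`), and the DIMENSION check
`oneRatioThreeCrossersDim_false_above_six` (p129945: the `d`-analogue with threshold `(k₀+1)^{-(d-1)}` is false for
`d > 6` under (t-c)) — all in `Theorems.NonProliferation`.

Composition (kernel-checked below, no `sorry` outside the four stubs):
`NonProliferation_of : stub_oneRatioThreeCrossers → stub_subshellCrossers → stub_disjointShellsIndep →
 stub_shellOfBoxCrossers → NonProliferation`, through `ladder` (induction on the number `j` of nested shells: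
`P(Sh-three(a, k₀(k₀+1)^j a)) ≤ q^{j+1}` for all `a ≥ a₀`) and the landed socket at ratio `k = k₀(k₀+1)^j` with
`726 k₀² q ((k₀+1)² q)^j ≤ 1/2`.

Disproof used (`Cruxes/NonProliferation/Disproof.lean`, 05:53Z; landed `Negative/{AboveSix,MZeroSlice}`):
`nonProliferation_false_without_dimThree` is honoured at the single open stub — for `d ≥ 7` under (t-c) the box
three-crosser probability at every fixed ratio tends to ONE as the scale grows (`…ThreeCrosserDecayAboveSix`, p124280),
box ⊆ shell (`stub_shellOfBoxCrossers`), so `stub_oneRatioThreeCrossers` with `3 ↦ d` is false there while the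
other three stubs and the glue are dimension-free; the `M = 0` slice is not used (three crossers: the line lives in
the sure-crossing regime `P(B(m) ↔ ∂ⁱⁿB(km)) → 1 ∀ k`, `crossing_tendsto_one_of_not_nonProliferation`);
`-- Targets`: none posted. Dead lines (`Lines/Sketch-dead.md`, `Lines/birth-merge-ledger-dead.md`): the open stub
here IMPLIES the dead `stub_threeCrosserDecay` (via stubs 2–4 + `threeCrosserDecay_of_pow`) and inherits its wall —
uniformity in the inner scale `a` at one ratio, for which no engine exists (`FixedInnerDecay`, p127413, is the
non-uniform shadow); what is new is that the RATE is no longer part of the obligation (finite-size criterion with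
order-one threshold `(k₀+1)^{-2}` instead of `o(k^{-2})` along `k → ∞`), and three provable-now shell lemmas.
-/

noncomputable section

namespace Summit.CriticalPhenomena.PercolationContinuityZ3.Cruxes.NonProliferation.AvoidanceCostCovering

open MeasureTheory Filter Topology
open Literature.Probability.LatticeModels Literature.Probability.Percolation
open Summit.CriticalPhenomena.PercolationContinuityZ3.Theorems.NonProliferation
open Summit.CriticalPhenomena.PercolationContinuityZ3.Theorems.NonProliferation.Negative
open Summit.CriticalPhenomena.PercolationContinuityZ3.Theses.PercNonProliferation

/-! ## Vocabulary of the line (abbreviations; the registered stubs spell everything out) -/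

/-- The critical bond measure on `ℤ^d`. -/
abbrev Pc (d : ℕ) : Measure (BondConfig (Site d)) := bondPercolation (zdGraph d) (criticalProbI d)

/-- The closed shell `Sh(a, b) = {v ∈ ℤ^d : a ≤ ‖v‖∞ ≤ b}` = `B(b)` minus the interior of `B(a)`. -/
def shell (d a b : ℕ) : Set (Site d) := {v | v ∈ box d b ∧ ∃ i : Fin d, (a : ℤ) ≤ |v i|}

/-- **Shell multi-crosser event** `Sh-multi_r(a, b)`: `r+1` points of `B(a)` (hence of the inner sphere `‖v‖∞ = a`),
each joined INSIDE THE SHELL `Sh(a,b)` to the outer sphere `∂ⁱⁿB(b)`, pairwise NOT joined inside `Sh(a,b)` —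
representatives of `r+1` distinct clusters of the open graph induced on `Sh(a,b)` joining its two boundary spheres. -/
def shellMulti (d r a b : ℕ) : Set (BondConfig (Site d)) :=
  {ω | ∃ x : Fin (r + 1) → Site d, (∀ i, x i ∈ box d a) ∧
    (∀ i, ∃ y ∈ innerBoundary (zdGraph d) (box d b),
      ω ∈ openConnIn {v : Site d | v ∈ box d b ∧ ∃ l : Fin d, (a : ℤ) ≤ |v l|} (x i) y) ∧
    ∀ i j, i ≠ j → ω ∉ openConnIn {v : Site d | v ∈ box d b ∧ ∃ l : Fin d, (a : ℤ) ≤ |v l|} (x i) (x j)}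

/-- **Box multi-crosser event** `multi_r(m, L)` (the socket's event; at `L = 2m` it is `repEvent d r m`): `r+1` points
of `B(m)`, each joined inside `B(L)` to `∂ⁱⁿB(L)`, pairwise not joined inside `B(L)`. -/
def boxMulti (d r m L : ℕ) : Set (BondConfig (Site d)) :=
  {ω | ∃ x : Fin (r + 1) → Site d, (∀ i, x i ∈ box d m) ∧
    (∀ i, ∃ y ∈ innerBoundary (zdGraph d) (box d L),
      ω ∈ openConnIn (↑(box d L) : Set (Site d)) (x i) y) ∧
    ∀ i j, i ≠ j → ω ∉ openConnIn (↑(box d L) : Set (Site d)) (x i) (x j)}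

/-- At ratio `2` the box multi-crosser event IS `repEvent`. -/
theorem boxMulti_two_mul (d r m : ℕ) : boxMulti d r m (2 * m) = repEvent d r m := rfl

/-! ## Registered stubs (statements) -/

namespace Stubs

/-- `stub_oneRatioThreeCrossers` (OPEN — the `d = 3` input; the card's `AvoidanceCost`/`CoveringDecay` in the
finite-size form endorsed by triage r2-2: ONE aspect ratio `k₀`, THREE crossers, threshold of order `k₀⁻²`, uniform
in the scale): there are `k₀ ≥ 2`, `a₀ ≥ 1` and `q` with `(k₀+1)² q < 1` such that for EVERY `a ≥ a₀` the critical
probability of three shell-distinct crossers of `Sh(a, k₀ a)` is `≤ q`. Equivalent (given stubs 2–3) to the power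
decay of the shell three-crosser probability with some exponent `> 2`; implies the dead `stub_threeCrosserDecay`;
numerically `k₀² P₃(k₀) ≈ 4.2 (k₀ = 12) → < 1` near `k₀ ≈ 25–50` (`ζ₃,eff ≈ 3.0–3.4`); void at `k₀ = 2`
(`P = 1.000`); false for `d ≥ 7` under (t-c) (`Negative.nonProliferation_false_without_dimThree`, p124280). -/
def stub_oneRatioThreeCrossers : Prop :=
  ∃ k₀ a₀ : ℕ, ∃ q : ℝ, 2 ≤ k₀ ∧ 1 ≤ a₀ ∧ ((k₀ : ℝ) + 1) ^ 2 * q < 1 ∧ ∀ a : ℕ, a₀ ≤ a →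
    (bondPercolation (zdGraph 3) (criticalProbI 3)).real
      {ω | ∃ x : Fin (2 + 1) → Site 3, (∀ i, x i ∈ box 3 a) ∧
        (∀ i, ∃ y ∈ innerBoundary (zdGraph 3) (box 3 (k₀ * a)),
          ω ∈ openConnIn {v : Site 3 | v ∈ box 3 (k₀ * a) ∧ ∃ l : Fin 3, (a : ℤ) ≤ |v l|} (x i) y) ∧
        ∀ i j, i ≠ j →
          ω ∉ openConnIn {v : Site 3 | v ∈ box 3 (k₀ * a) ∧ ∃ l : Fin 3, (a : ℤ) ≤ |v l|} (x i) (x j)} ≤ q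

/-- `stub_subshellCrossers` (provable now, deterministic, every `d`, `r`, lattice configurations): for radii
`a ≤ b ≤ c` and `a ≤ b' ≤ c`, `r+1` shell-distinct crossers of `Sh(a,c)` restrict to `r+1` shell-distinct crossers
of the inner sub-shell `Sh(a,b)` (prefix of each crossing path up to its FIRST visit to `∂ⁱⁿB(b)`; sup-norm moves by
`≤ 1` per lattice step) and of the outer sub-shell `Sh(b',c)` (suffix from the LAST visit to `B(b')`, a point of
norm `b'`); distinctness is inherited because the sub-shells lie inside `Sh(a,c)` (joined inside a sub-shell ⇒
joined inside `Sh(a,c)`, then `x_i ~ u_i ~ u_j ~ x_j`). -/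
def stub_subshellCrossers : Prop :=
  ∀ (d r a b b' c : ℕ) (ω : BondConfig (Site d)), a ≤ b → b ≤ c → a ≤ b' → b' ≤ c →
    ω ⊆ (zdGraph d).edgeSet →
    ω ∈ {ω | ∃ x : Fin (r + 1) → Site d, (∀ i, x i ∈ box d a) ∧
      (∀ i, ∃ y ∈ innerBoundary (zdGraph d) (box d c),
        ω ∈ openConnIn {v : Site d | v ∈ box d c ∧ ∃ l : Fin d, (a : ℤ) ≤ |v l|} (x i) y) ∧
      ∀ i j, i ≠ j → ω ∉ openConnIn {v : Site d | v ∈ box d c ∧ ∃ l : Fin d, (a : ℤ) ≤ |v l|} (x i) (x j)} →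
    ω ∈ {ω | ∃ x : Fin (r + 1) → Site d, (∀ i, x i ∈ box d a) ∧
      (∀ i, ∃ y ∈ innerBoundary (zdGraph d) (box d b),
        ω ∈ openConnIn {v : Site d | v ∈ box d b ∧ ∃ l : Fin d, (a : ℤ) ≤ |v l|} (x i) y) ∧
      ∀ i j, i ≠ j → ω ∉ openConnIn {v : Site d | v ∈ box d b ∧ ∃ l : Fin d, (a : ℤ) ≤ |v l|} (x i) (x j)} ∧
    ω ∈ {ω | ∃ x : Fin (r + 1) → Site d, (∀ i, x i ∈ box d b') ∧
      (∀ i, ∃ y ∈ innerBoundary (zdGraph d) (box d c),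
        ω ∈ openConnIn {v : Site d | v ∈ box d c ∧ ∃ l : Fin d, (b' : ℤ) ≤ |v l|} (x i) y) ∧
      ∀ i j, i ≠ j → ω ∉ openConnIn {v : Site d | v ∈ box d c ∧ ∃ l : Fin d, (b' : ℤ) ≤ |v l|} (x i) (x j)}

/-- `stub_disjointShellsIndep` (provable now, every `d`, `p`, `r`): for `b < b'` the shells `Sh(a,b) ⊆ B(b)` and
`Sh(b',c) ⊆ {‖v‖∞ ≥ b'}` are vertex-disjoint, the two shell multi-crosser events are determined by the (finitely many)
unordered pairs inside their own shell (`determinedBy_openConnIn_sym2`, closure of `DeterminedBy` under `∃/∀/¬`), so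
they are independent under the product measure (`DCT16.real_inter_of_determinedBy_disjoint`): `P(A ∩ B) ≤ P(A) P(B)`. -/
def stub_disjointShellsIndep : Prop :=
  ∀ (d r a b b' c : ℕ) (p : unitInterval), b < b' →
    (bondPercolation (zdGraph d) p).real
      ({ω | ∃ x : Fin (r + 1) → Site d, (∀ i, x i ∈ box d a) ∧
        (∀ i, ∃ y ∈ innerBoundary (zdGraph d) (box d b),
          ω ∈ openConnIn {v : Site d | v ∈ box d b ∧ ∃ l : Fin d, (a : ℤ) ≤ |v l|} (x i) y) ∧
        ∀ i j, i ≠ j → ω ∉ openConnIn {v : Site d | v ∈ box d b ∧ ∃ l : Fin d, (a : ℤ) ≤ |v l|} (x i) (x j)} ∩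
      {ω | ∃ x : Fin (r + 1) → Site d, (∀ i, x i ∈ box d b') ∧
        (∀ i, ∃ y ∈ innerBoundary (zdGraph d) (box d c),
          ω ∈ openConnIn {v : Site d | v ∈ box d c ∧ ∃ l : Fin d, (b' : ℤ) ≤ |v l|} (x i) y) ∧
        ∀ i j, i ≠ j → ω ∉ openConnIn {v : Site d | v ∈ box d c ∧ ∃ l : Fin d, (b' : ℤ) ≤ |v l|} (x i) (x j)}) ≤
    (bondPercolation (zdGraph d) p).real
      {ω | ∃ x : Fin (r + 1) → Site d, (∀ i, x i ∈ box d a) ∧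
        (∀ i, ∃ y ∈ innerBoundary (zdGraph d) (box d b),
          ω ∈ openConnIn {v : Site d | v ∈ box d b ∧ ∃ l : Fin d, (a : ℤ) ≤ |v l|} (x i) y) ∧
        ∀ i j, i ≠ j → ω ∉ openConnIn {v : Site d | v ∈ box d b ∧ ∃ l : Fin d, (a : ℤ) ≤ |v l|} (x i) (x j)} *
    (bondPercolation (zdGraph d) p).real
      {ω | ∃ x : Fin (r + 1) → Site d, (∀ i, x i ∈ box d b') ∧
        (∀ i, ∃ y ∈ innerBoundary (zdGraph d) (box d c),
          ω ∈ openConnIn {v : Site d | v ∈ box d c ∧ ∃ l : Fin d, (b' : ℤ) ≤ |v l|} (x i) y) ∧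
        ∀ i j, i ≠ j → ω ∉ openConnIn {v : Site d | v ∈ box d c ∧ ∃ l : Fin d, (b' : ℤ) ≤ |v l|} (x i) (x j)}

/-- `stub_shellOfBoxCrossers` (provable now, deterministic, every `d`, `r`, `m ≤ L`, lattice configurations):
`r+1` box-distinct crossers of `B(L) ∖ B(m)` (the socket's event) give `r+1` shell-distinct crossers of `Sh(m, L)`:
replace each representative `x_i ∈ B(m)` by the LAST point `u_i` of its crossing path in `B(m)` (norm exactly `m`;
the suffix lies in `Sh(m,L)`); two suffix-representatives joined inside `Sh(m,L) ⊆ B(L)` would join `x_i` to `x_j`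
inside `B(L)`. -/
def stub_shellOfBoxCrossers : Prop :=
  ∀ (d r m L : ℕ) (ω : BondConfig (Site d)), m ≤ L → ω ⊆ (zdGraph d).edgeSet →
    ω ∈ {ω | ∃ x : Fin (r + 1) → Site d, (∀ i, x i ∈ box d m) ∧
      (∀ i, ∃ y ∈ innerBoundary (zdGraph d) (box d L),
        ω ∈ openConnIn (↑(box d L) : Set (Site d)) (x i) y) ∧
      ∀ i j, i ≠ j → ω ∉ openConnIn (↑(box d L) : Set (Site d)) (x i) (x j)} →
    ω ∈ {ω | ∃ x : Fin (r + 1) → Site d, (∀ i, x i ∈ box d m) ∧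
      (∀ i, ∃ y ∈ innerBoundary (zdGraph d) (box d L),
        ω ∈ openConnIn {v : Site d | v ∈ box d L ∧ ∃ l : Fin d, (m : ℤ) ≤ |v l|} (x i) y) ∧
      ∀ i j, i ≠ j → ω ∉ openConnIn {v : Site d | v ∈ box d L ∧ ∃ l : Fin d, (m : ℤ) ≤ |v l|} (x i) (x j)}

end Stubs

/-! ## The stubs, spelled out (registered by name + signature) -/

/-- Registered stub `stub_oneRatioThreeCrossers` — OPEN (the `d = 3` input of the line; hardest). Lead a1 (2026-08-17):
no a-uniform engine exists (hyperscaling; any proof must fail in `d ≥ 7`, `oneRatioThreeCrossersDim_false_above_six` p129945);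
calibrated as uniform power decay with some exponent `> 2` (`oneRatioThreeCrossers_iff_shellThreeCrosserDecay` p130012); closes the
crux by `nonProliferation_of_oneRatioThreeCrossers` (p129664), as does any member of the family `C(r, k₀)` (p130211) and uniform shell
tightness at one ratio (p138802). NUMERICALLY TRUE (kit j020551–3, j020662, j020668, j021666, ≈ 75 core-h, `numerics-shellThree.md`):
`(k₀+1)² P₃ = 0.55/0.68/0.77` at `a = 2/3/4`, `k₀ = 48`; `0.36/0.45/0.47` at `k₀ = 64`; the law of `N(a, k₀a)` saturates in `a`
(`a^{-0.8}` correction, plateau factor ≈ 1.2–1.5) ⇒ witness `k₀ = 64`, `a₀ ≈ 8`, `q = 1.6·10⁻⁴`. Handed back `promote-stub`. -/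
theorem stub_oneRatioThreeCrossers :
    ∃ k₀ a₀ : ℕ, ∃ q : ℝ, 2 ≤ k₀ ∧ 1 ≤ a₀ ∧ ((k₀ : ℝ) + 1) ^ 2 * q < 1 ∧ ∀ a : ℕ, a₀ ≤ a →
    (bondPercolation (zdGraph 3) (criticalProbI 3)).real
      {ω | ∃ x : Fin (2 + 1) → Site 3, (∀ i, x i ∈ box 3 a) ∧
        (∀ i, ∃ y ∈ innerBoundary (zdGraph 3) (box 3 (k₀ * a)),
          ω ∈ openConnIn {v : Site 3 | v ∈ box 3 (k₀ * a) ∧ ∃ l : Fin 3, (a : ℤ) ≤ |v l|} (x i) y) ∧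
        ∀ i j, i ≠ j →
          ω ∉ openConnIn {v : Site 3 | v ∈ box 3 (k₀ * a) ∧ ∃ l : Fin 3, (a : ℤ) ≤ |v l|} (x i) (x j)} ≤ q := by
  sorry

/-- Registered stub `stub_subshellCrossers` — LANDED (p129292, `Theorems.NonProliferation.stub_subshellCrossers`). -/
theorem stub_subshellCrossers :
    ∀ (d r a b b' c : ℕ) (ω : BondConfig (Site d)), a ≤ b → b ≤ c → a ≤ b' → b' ≤ c →
    ω ⊆ (zdGraph d).edgeSet →
    ω ∈ {ω | ∃ x : Fin (r + 1) → Site d, (∀ i, x i ∈ box d a) ∧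
      (∀ i, ∃ y ∈ innerBoundary (zdGraph d) (box d c),
        ω ∈ openConnIn {v : Site d | v ∈ box d c ∧ ∃ l : Fin d, (a : ℤ) ≤ |v l|} (x i) y) ∧
      ∀ i j, i ≠ j → ω ∉ openConnIn {v : Site d | v ∈ box d c ∧ ∃ l : Fin d, (a : ℤ) ≤ |v l|} (x i) (x j)} →
    ω ∈ {ω | ∃ x : Fin (r + 1) → Site d, (∀ i, x i ∈ box d a) ∧
      (∀ i, ∃ y ∈ innerBoundary (zdGraph d) (box d b),
        ω ∈ openConnIn {v : Site d | v ∈ box d b ∧ ∃ l : Fin d, (a : ℤ) ≤ |v l|} (x i) y) ∧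
      ∀ i j, i ≠ j → ω ∉ openConnIn {v : Site d | v ∈ box d b ∧ ∃ l : Fin d, (a : ℤ) ≤ |v l|} (x i) (x j)} ∧
    ω ∈ {ω | ∃ x : Fin (r + 1) → Site d, (∀ i, x i ∈ box d b') ∧
      (∀ i, ∃ y ∈ innerBoundary (zdGraph d) (box d c),
        ω ∈ openConnIn {v : Site d | v ∈ box d c ∧ ∃ l : Fin d, (b' : ℤ) ≤ |v l|} (x i) y) ∧
      ∀ i j, i ≠ j → ω ∉ openConnIn {v : Site d | v ∈ box d c ∧ ∃ l : Fin d, (b' : ℤ) ≤ |v l|} (x i) (x j)} :=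
  Summit.CriticalPhenomena.PercolationContinuityZ3.Theorems.NonProliferation.stub_subshellCrossers

/-- Registered stub `stub_disjointShellsIndep` — LANDED (p129213, `Theorems.NonProliferation.stub_disjointShellsIndep`). -/
theorem stub_disjointShellsIndep :
    ∀ (d r a b b' c : ℕ) (p : unitInterval), b < b' →
    (bondPercolation (zdGraph d) p).real
      ({ω | ∃ x : Fin (r + 1) → Site d, (∀ i, x i ∈ box d a) ∧
        (∀ i, ∃ y ∈ innerBoundary (zdGraph d) (box d b),
          ω ∈ openConnIn {v : Site d | v ∈ box d b ∧ ∃ l : Fin d, (a : ℤ) ≤ |v l|} (x i) y) ∧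
        ∀ i j, i ≠ j → ω ∉ openConnIn {v : Site d | v ∈ box d b ∧ ∃ l : Fin d, (a : ℤ) ≤ |v l|} (x i) (x j)} ∩
      {ω | ∃ x : Fin (r + 1) → Site d, (∀ i, x i ∈ box d b') ∧
        (∀ i, ∃ y ∈ innerBoundary (zdGraph d) (box d c),
          ω ∈ openConnIn {v : Site d | v ∈ box d c ∧ ∃ l : Fin d, (b' : ℤ) ≤ |v l|} (x i) y) ∧
        ∀ i j, i ≠ j → ω ∉ openConnIn {v : Site d | v ∈ box d c ∧ ∃ l : Fin d, (b' : ℤ) ≤ |v l|} (x i) (x j)}) ≤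
    (bondPercolation (zdGraph d) p).real
      {ω | ∃ x : Fin (r + 1) → Site d, (∀ i, x i ∈ box d a) ∧
        (∀ i, ∃ y ∈ innerBoundary (zdGraph d) (box d b),
          ω ∈ openConnIn {v : Site d | v ∈ box d b ∧ ∃ l : Fin d, (a : ℤ) ≤ |v l|} (x i) y) ∧
        ∀ i j, i ≠ j → ω ∉ openConnIn {v : Site d | v ∈ box d b ∧ ∃ l : Fin d, (a : ℤ) ≤ |v l|} (x i) (x j)} *
    (bondPercolation (zdGraph d) p).real
      {ω | ∃ x : Fin (r + 1) → Site d, (∀ i, x i ∈ box d b') ∧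
        (∀ i, ∃ y ∈ innerBoundary (zdGraph d) (box d c),
          ω ∈ openConnIn {v : Site d | v ∈ box d c ∧ ∃ l : Fin d, (b' : ℤ) ≤ |v l|} (x i) y) ∧
        ∀ i j, i ≠ j → ω ∉ openConnIn {v : Site d | v ∈ box d c ∧ ∃ l : Fin d, (b' : ℤ) ≤ |v l|} (x i) (x j)} :=
  Summit.CriticalPhenomena.PercolationContinuityZ3.Theorems.NonProliferation.stub_disjointShellsIndep

/-- Registered stub `stub_shellOfBoxCrossers` — LANDED (p129273, `Theorems.NonProliferation.stub_shellOfBoxCrossers`). -/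
theorem stub_shellOfBoxCrossers :
    ∀ (d r m L : ℕ) (ω : BondConfig (Site d)), m ≤ L → ω ⊆ (zdGraph d).edgeSet →
    ω ∈ {ω | ∃ x : Fin (r + 1) → Site d, (∀ i, x i ∈ box d m) ∧
      (∀ i, ∃ y ∈ innerBoundary (zdGraph d) (box d L),
        ω ∈ openConnIn (↑(box d L) : Set (Site d)) (x i) y) ∧
      ∀ i j, i ≠ j → ω ∉ openConnIn (↑(box d L) : Set (Site d)) (x i) (x j)} →
    ω ∈ {ω | ∃ x : Fin (r + 1) → Site d, (∀ i, x i ∈ box d m) ∧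
      (∀ i, ∃ y ∈ innerBoundary (zdGraph d) (box d L),
        ω ∈ openConnIn {v : Site d | v ∈ box d L ∧ ∃ l : Fin d, (m : ℤ) ≤ |v l|} (x i) y) ∧
      ∀ i j, i ≠ j → ω ∉ openConnIn {v : Site d | v ∈ box d L ∧ ∃ l : Fin d, (m : ℤ) ≤ |v l|} (x i) (x j)} :=
  Summit.CriticalPhenomena.PercolationContinuityZ3.Theorems.NonProliferation.stub_shellOfBoxCrossers

/-! ## Bridges between the spelled-out statements and the line's vocabulary (`Iff.rfl`) -/

theorem stub_subshellCrossers_iff : Stubs.stub_subshellCrossers ↔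
    ∀ (d r a b b' c : ℕ) (ω : BondConfig (Site d)), a ≤ b → b ≤ c → a ≤ b' → b' ≤ c →
      ω ⊆ (zdGraph d).edgeSet → ω ∈ shellMulti d r a c → ω ∈ shellMulti d r a b ∧ ω ∈ shellMulti d r b' c :=
  Iff.rfl

theorem stub_disjointShellsIndep_iff : Stubs.stub_disjointShellsIndep ↔
    ∀ (d r a b b' c : ℕ) (p : unitInterval), b < b' →
      (bondPercolation (zdGraph d) p).real (shellMulti d r a b ∩ shellMulti d r b' c) ≤
        (bondPercolation (zdGraph d) p).real (shellMulti d r a b) *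
          (bondPercolation (zdGraph d) p).real (shellMulti d r b' c) :=
  Iff.rfl

theorem stub_shellOfBoxCrossers_iff : Stubs.stub_shellOfBoxCrossers ↔
    ∀ (d r m L : ℕ) (ω : BondConfig (Site d)), m ≤ L → ω ⊆ (zdGraph d).edgeSet →
      ω ∈ boxMulti d r m L → ω ∈ shellMulti d r m L :=
  Iff.rfl

theorem stub_oneRatioThreeCrossers_iff : Stubs.stub_oneRatioThreeCrossers ↔
    ∃ k₀ a₀ : ℕ, ∃ q : ℝ, 2 ≤ k₀ ∧ 1 ≤ a₀ ∧ ((k₀ : ℝ) + 1) ^ 2 * q < 1 ∧ ∀ a : ℕ, a₀ ≤ a →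
      (Pc 3).real (shellMulti 3 2 a (k₀ * a)) ≤ q :=
  Iff.rfl

/-! ## The bootstrap: submultiplicativity over nested vertex-disjoint shells -/

/-- **Shell submultiplicativity** (stubs 2 + 3, a.e. lattice support): for `a ≤ b < b' ≤ c`,
`P(Sh-multi_r(a,c)) ≤ P(Sh-multi_r(a,b)) · P(Sh-multi_r(b',c))`. -/
theorem shellMulti_submult (h2 : Stubs.stub_subshellCrossers) (h3 : Stubs.stub_disjointShellsIndep)
    (d r a b b' c : ℕ) (p : unitInterval) (hab : a ≤ b) (hbb' : b < b') (hb'c : b' ≤ c) :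
    (bondPercolation (zdGraph d) p).real (shellMulti d r a c) ≤
      (bondPercolation (zdGraph d) p).real (shellMulti d r a b) *
        (bondPercolation (zdGraph d) p).real (shellMulti d r b' c) := by
  rw [stub_subshellCrossers_iff] at h2
  rw [stub_disjointShellsIndep_iff] at h3
  have hincl : ∀ᵐ ω ∂(bondPercolation (zdGraph d) p),
      ω ∈ shellMulti d r a c → ω ∈ shellMulti d r a b ∩ shellMulti d r b' c := by
    filter_upwards [ae_subset_edgeSet (zdGraph d) p] with ω hω hmem
    exact h2 d r a b b' c ω hab (by omega) (by omega) hb'c hω hmem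
  calc (bondPercolation (zdGraph d) p).real (shellMulti d r a c)
      ≤ (bondPercolation (zdGraph d) p).real (shellMulti d r a b ∩ shellMulti d r b' c) := by
        simp only [measureReal_def]
        exact ENNReal.toReal_mono (measure_ne_top _ _) (measure_mono_ae hincl)
    _ ≤ _ := h3 d r a b b' c p hbb'

/-- **The ladder** (induction on the number of nested shells): if `(Pc 3)(Sh-three(a, k₀ a)) ≤ q` for all
`a ≥ a₀`, then `(Pc 3)(Sh-three(a, k₀ (k₀+1)^j a)) ≤ q^{j+1}` for all `j` and all `a ≥ a₀` — the shells
`Sh((k₀+1)^i a, k₀ (k₀+1)^i a)`, `i ≤ j`, are pairwise vertex-disjoint and each carries three crossers. -/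
theorem ladder (h2 : Stubs.stub_subshellCrossers) (h3 : Stubs.stub_disjointShellsIndep)
    {k₀ a₀ : ℕ} {q : ℝ} (hk₀ : 2 ≤ k₀) (ha₀ : 1 ≤ a₀)
    (hcrit : ∀ a : ℕ, a₀ ≤ a → (Pc 3).real (shellMulti 3 2 a (k₀ * a)) ≤ q) :
    ∀ j a : ℕ, a₀ ≤ a → (Pc 3).real (shellMulti 3 2 a (k₀ * (k₀ + 1) ^ j * a)) ≤ q ^ (j + 1) := by
  have hq0 : 0 ≤ q := le_trans measureReal_nonneg (hcrit a₀ le_rfl)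
  intro j
  induction j with
  | zero =>
    intro a ha
    simpa only [pow_zero, mul_one, pow_one, zero_add] using hcrit a ha
  | succ j ih =>
    intro a ha
    have ha1 : 1 ≤ a := le_trans ha₀ ha
    -- radii: b = k₀ (k₀+1)^j a (outer of the old big shell), b' = (k₀+1)^{j+1} a, c = k₀ (k₀+1)^{j+1} a
    have hpos : 0 < k₀ * (k₀ + 1) ^ j := Nat.mul_pos (by omega) (by positivity)
    have hab : a ≤ k₀ * (k₀ + 1) ^ j * a := Nat.le_mul_of_pos_left a hpos
    have hbb' : k₀ * (k₀ + 1) ^ j * a < (k₀ + 1) ^ (j + 1) * a := by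
      have hpos' : 0 < (k₀ + 1) ^ j * a := Nat.mul_pos (by positivity) (by omega)
      calc k₀ * (k₀ + 1) ^ j * a < k₀ * (k₀ + 1) ^ j * a + (k₀ + 1) ^ j * a := Nat.lt_add_of_pos_right hpos'
        _ = (k₀ + 1) ^ (j + 1) * a := by ring
    have hb'c : (k₀ + 1) ^ (j + 1) * a ≤ k₀ * (k₀ + 1) ^ (j + 1) * a := by
      rw [mul_assoc]
      exact Nat.le_mul_of_pos_left _ (by omega)
    have hstep := shellMulti_submult h2 h3 3 2 a (k₀ * (k₀ + 1) ^ j * a) ((k₀ + 1) ^ (j + 1) * a)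
      (k₀ * (k₀ + 1) ^ (j + 1) * a) (criticalProbI 3) hab hbb' hb'c
    have hnew : (Pc 3).real (shellMulti 3 2 ((k₀ + 1) ^ (j + 1) * a) (k₀ * (k₀ + 1) ^ (j + 1) * a)) ≤ q := by
      have h := hcrit ((k₀ + 1) ^ (j + 1) * a) (le_trans ha (Nat.le_mul_of_pos_left a (by positivity)))
      rwa [← mul_assoc] at h
    have hold := ih a ha
    calc (Pc 3).real (shellMulti 3 2 a (k₀ * (k₀ + 1) ^ (j + 1) * a))
        ≤ (Pc 3).real (shellMulti 3 2 a (k₀ * (k₀ + 1) ^ j * a)) *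
            (Pc 3).real (shellMulti 3 2 ((k₀ + 1) ^ (j + 1) * a) (k₀ * (k₀ + 1) ^ (j + 1) * a)) := hstep
      _ ≤ q ^ (j + 1) * q := by
          apply mul_le_mul hold hnew measureReal_nonneg (pow_nonneg hq0 _)
      _ = q ^ (j + 1 + 1) := by ring

/-! ## The line's composition -/

/-- **The line's composition.** `stub_oneRatioThreeCrossers → stub_subshellCrossers → stub_disjointShellsIndep →
stub_shellOfBoxCrossers → crux`: the criterion and the ladder give `P(Sh-three(m, k m)) ≤ q^{j+1}` at the ratio
`k = k₀ (k₀+1)^j` for every `m ≥ a₀`; box three-crossers are shell three-crossers a.e. (`stub_shellOfBoxCrossers`);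
with `j` chosen so that `726 k₀² q ((k₀+1)² q)^j ≤ 1/2` the landed socket
`nonProliferation_of_frequently_multiCross` (mid-sphere covering with `≤ 726 k²` translates, multiplicity `r = 2`)
returns the crux (`M = 1452 k²`, `c = 1/2`). -/
theorem NonProliferation_of (h1 : Stubs.stub_oneRatioThreeCrossers) (h2 : Stubs.stub_subshellCrossers)
    (h3 : Stubs.stub_disjointShellsIndep) (h4 : Stubs.stub_shellOfBoxCrossers) : NonProliferation := by
  rw [stub_oneRatioThreeCrossers_iff] at h1
  rw [stub_shellOfBoxCrossers_iff] at h4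
  obtain ⟨k₀, a₀, q, hk₀, ha₀, hθ, hcrit⟩ := h1
  have hq0 : 0 ≤ q := le_trans measureReal_nonneg (hcrit a₀ le_rfl)
  have hlad := ladder h2 h3 hk₀ ha₀ hcrit
  -- the base `t = (k₀+1)² q ∈ [0,1)` and the number of shells `j`
  set t : ℝ := ((k₀ : ℝ) + 1) ^ 2 * q with ht
  have ht0 : 0 ≤ t := by positivity
  have ht1 : t < 1 := hθ
  set A : ℝ := 726 * (k₀ : ℝ) ^ 2 * q with hA
  have hA0 : 0 ≤ A := by positivity
  obtain ⟨j, hj⟩ := exists_pow_lt_of_lt_one (show (0 : ℝ) < 1 / (2 * (A + 1)) by positivity) ht1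
  have hjA : A * t ^ j ≤ 1 / 2 := by
    have h1 : A * t ^ j ≤ A * (1 / (2 * (A + 1))) := mul_le_mul_of_nonneg_left hj.le hA0
    have h2 : A * (1 / (2 * (A + 1))) ≤ 1 / 2 := by
      rw [mul_one_div, div_le_iff₀ (by positivity)]
      nlinarith
    exact h1.trans h2
  -- the ratio `k = k₀ (k₀+1)^j ≥ 2`
  have hK : 1 ≤ (k₀ + 1) ^ j := Nat.one_le_pow _ _ (by omega)
  have hk2 : 2 ≤ k₀ * (k₀ + 1) ^ j :=
    calc 2 ≤ k₀ := hk₀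
      _ = k₀ * 1 := (mul_one _).symm
      _ ≤ k₀ * (k₀ + 1) ^ j := Nat.mul_le_mul_left _ hK
  refine nonProliferation_of_frequently_multiCross ⟨k₀ * (k₀ + 1) ^ j, 2, hk2, Eventually.frequently ?_⟩
  filter_upwards [eventually_ge_atTop a₀] with m hm
  have hmL : m ≤ k₀ * (k₀ + 1) ^ j * m := Nat.le_mul_of_pos_left m (Nat.mul_pos (by omega) (by positivity))
  -- box three-crossers are shell three-crossers (a.e.), then the ladder
  have hincl : ∀ᵐ ω ∂(Pc 3), ω ∈ boxMulti 3 2 m (k₀ * (k₀ + 1) ^ j * m) →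
      ω ∈ shellMulti 3 2 m (k₀ * (k₀ + 1) ^ j * m) := by
    filter_upwards [ae_subset_edgeSet (zdGraph 3) (criticalProbI 3)] with ω hω hmem
    exact h4 3 2 m _ ω hmL hω hmem
  have hbox : (Pc 3).real (boxMulti 3 2 m (k₀ * (k₀ + 1) ^ j * m)) ≤ q ^ (j + 1) := by
    calc (Pc 3).real (boxMulti 3 2 m (k₀ * (k₀ + 1) ^ j * m))
        ≤ (Pc 3).real (shellMulti 3 2 m (k₀ * (k₀ + 1) ^ j * m)) := by
          simp only [measureReal_def]
          exact ENNReal.toReal_mono (measure_ne_top _ _) (measure_mono_ae hincl)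
      _ ≤ q ^ (j + 1) := hlad j m hm
  -- arithmetic: 726 (k₀ (k₀+1)^j)² q^{j+1} = A t^j ≤ 1/2
  have hcast : ((k₀ * (k₀ + 1) ^ j : ℕ) : ℝ) = (k₀ : ℝ) * ((k₀ : ℝ) + 1) ^ j := by push_cast; ring
  have halg : 726 * ((k₀ : ℝ) * ((k₀ : ℝ) + 1) ^ j) ^ 2 * q ^ (j + 1) = A * t ^ j := by
    rw [hA, ht]
    generalize ((k₀ : ℝ) + 1) = K
    ring
  show 726 * ((k₀ * (k₀ + 1) ^ j : ℕ) : ℝ) ^ 2 * (Pc 3).real (boxMulti 3 2 m (k₀ * (k₀ + 1) ^ j * m)) ≤ 1 / 2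
  calc 726 * ((k₀ * (k₀ + 1) ^ j : ℕ) : ℝ) ^ 2 * (Pc 3).real (boxMulti 3 2 m (k₀ * (k₀ + 1) ^ j * m))
      ≤ 726 * ((k₀ * (k₀ + 1) ^ j : ℕ) : ℝ) ^ 2 * q ^ (j + 1) := by gcongr
    _ = 726 * ((k₀ : ℝ) * ((k₀ : ℝ) + 1) ^ j) ^ 2 * q ^ (j + 1) := by rw [hcast]
    _ = A * t ^ j := halg
    _ ≤ 1 / 2 := hjA

/-- **The crux, by name, modulo the stubs** (three provable now, one open). -/
theorem NonProliferation_proof : NonProliferation :=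
  NonProliferation_of stub_oneRatioThreeCrossers stub_subshellCrossers stub_disjointShellsIndep
    stub_shellOfBoxCrossers

/-! ## Calibration of the open stub: its uniform power form, and the converse -/

/-- The power form (the card's `CoveringDecay`/`ThreeCrosserDecay` at `M = 2`, for shells, UNIFORM in `a ≥ a₀`)
implies the registered finite-ratio stub: pick `k₀` with `C (k₀+1)² k₀^{-(2+δ)} < 1`. Recorded as a statement
(`Prop`), not proved here — it is the easy direction and not on the line's path. -/
def ShellThreeCrosserDecay : Prop :=
  ∃ a₀ : ℕ, ∃ C δ : ℝ, 1 ≤ a₀ ∧ 0 < δ ∧ ∀ k a : ℕ, 2 ≤ k → a₀ ≤ a →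
    (Pc 3).real (shellMulti 3 2 a (k * a)) ≤ C * (k : ℝ) ^ (-(2 + δ))

end Summit.CriticalPhenomena.PercolationContinuityZ3.Cruxes.NonProliferation.AvoidanceCostCovering

end
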